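import Mathlib
import HarnessLib

/-!
# Orthogonal projection of a standard Gaussian is the standard Gaussian of the subspace (the HMC momenta's traceless step)

HONEST FRAMING: exact (Metropolis-corrected) sampling algorithms for lattice gauge theory;
figures of merit are autocorrelation/cost numbers at stated couplings and volumes; no
continuum-physics claim.

Venture `LatticeQCDFlow` (cell pub-lqcd), topic `Exactness`, FANOUT row 9 (eng-latcore, the
engine `latflow.core`).  NEW WORK of the cell over Mathlib (`stdGaussian`, `charFun_stdGaussian`,
`Measure.ext_of_charFun`, `Submodule.orthogonalProjectionOnto`); nothing is cited as a fact.

The HMC momentum refresh (`csrc/latcore_template.c` `lc_momenta`, `sun.random_algebra`,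
`hmc.HMC.momenta`) must draw `P = iH` with density `∝ e^{tr P²} = e^{−tr H²}` — the kinetic term
`hmc.HMC.kinetic = −tr P²` of the Hamiltonian whose violation `ΔH` the accept step tests
(`SplittingIntegrator.lean`, `SplittingWords.lean` take the momentum law as the Gaussian of the
kinetic energy).  The engine builds `H` from independent Gaussians (Box–Muller, `BoxMuller.lean`):
off-diagonal `re, im` with standard deviation `½` (density `∝ e^{−2|h|²}`, the off-diagonal part of
`e^{−tr H²}` — a scaling, not restated), and the DIAGONAL as `d = g − mean(g)·𝟙` with
`g ∼ N(0, ½ I_N)`: a projection, which is the content of this file.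

* **`stdGaussian_map_orthogonalProjectionOnto`** — for every subspace `K` of a finite-dimensional
  real inner product space `E`: `(stdGaussian E).map K.orthogonalProjectionOnto = stdGaussian K`
  (characteristic functions: `⟪P x, t⟫ = ⟪x, t⟫` for `t ∈ K`);
* `ones`, `tracelessSub n = (ℝ𝟙)ᗮ = {Σ xᵢ = 0}` (`mem_tracelessSub_iff`), `subMean x = x − mean(x)𝟙`;
  `subMean_eq_starProjection` — subtracting the mean IS the orthogonal projection onto the traceless
  hyperplane;
* **`stdGaussian_map_subMean`** — THE ENGINE'S TRACELESS STEP IS EXACT: `x ↦ x − mean(x)𝟙` pushes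
  `N(0, I_N)` to the standard Gaussian of the traceless hyperplane (density `∝ e^{−|d|²/2}` for its
  own Lebesgue measure); with the engine's factor `√½` the diagonal `D` of `H` has density `∝ e^{−tr D²}`.

NOT CLAIMED: the identification of (traceless diagonal ⊕ off-diagonal pairs) with the trace inner
product space of traceless Hermitian matrices (coordinates only; `SUNGeneratorSum.lean` has the
generator basis), floating point.
-/

namespace Summit.Ventures.LatticeQCDFlow.Exactness

open MeasureTheory Measure ProbabilityTheory Complex WithLp
open scoped ENNReal InnerProductSpace

/-! ## §1 Projecting a standard Gaussian -/

section Projection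

variable {E : Type*} [NormedAddCommGroup E] [InnerProductSpace ℝ E] [FiniteDimensional ℝ E]
  [MeasurableSpace E] [BorelSpace E] (K : Submodule ℝ E)

omit [MeasurableSpace E] [BorelSpace E] in
/-- For `t ∈ K`: `⟪P_K x, t⟫ = ⟪x, t⟫`. -/
theorem inner_orthogonalProjectionOnto_coe (x : E) (t : K) :
    ⟪K.orthogonalProjectionOnto x, t⟫_ℝ = ⟪x, (t : E)⟫_ℝ := by
  have h := K.starProjection_inner_eq_zero x (t : E) t.2
  rw [inner_sub_left, sub_eq_zero] at h
  rw [Submodule.coe_inner, ← Submodule.starProjection_apply]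
  exact h.symm

/-- **The orthogonal projection of the standard Gaussian of `E` onto a subspace `K` is the standard
Gaussian of `K`.** -/
theorem stdGaussian_map_orthogonalProjectionOnto :
    (stdGaussian E).map K.orthogonalProjectionOnto = stdGaussian K := by
  have hP : Measurable (K.orthogonalProjectionOnto : E → K) := K.orthogonalProjectionOnto.continuous.measurable
  haveI : IsProbabilityMeasure ((stdGaussian E).map K.orthogonalProjectionOnto) := isProbabilityMeasure_map hP.aemeasurable
  apply Measure.ext_of_charFun
  funext t
  rw [charFun_apply, integral_map hP.aemeasurable (by fun_prop), charFun_stdGaussian]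
  simp_rw [inner_orthogonalProjectionOnto_coe K]
  rw [← charFun_apply, charFun_stdGaussian, Submodule.coe_norm]

end Projection

/-! ## §2 The engine's traceless step: subtracting the mean -/

section Traceless

variable (n : ℕ)

/-- The all-ones vector `𝟙 ∈ ℝⁿ`. -/
noncomputable def ones : EuclideanSpace ℝ (Fin n) := toLp 2 fun _ => 1

/-- `𝟙ᵢ = 1`. -/
@[simp] theorem ones_apply (i : Fin n) : ones n i = 1 := rfl

/-- `⟪𝟙, x⟫ = Σ xᵢ`. -/
theorem inner_ones_left (x : EuclideanSpace ℝ (Fin n)) : ⟪ones n, x⟫_ℝ = ∑ i, x i := by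
  rw [PiLp.inner_apply]
  simp [ones]

/-- `⟪𝟙, 𝟙⟫ = n`. -/
theorem inner_ones_ones : ⟪ones n, ones n⟫_ℝ = n := by
  rw [inner_ones_left]; simp

/-- **The traceless hyperplane** `{x | Σ xᵢ = 0} = (ℝ𝟙)ᗮ`. -/
noncomputable def tracelessSub : Submodule ℝ (EuclideanSpace ℝ (Fin n)) := (ℝ ∙ ones n)ᗮ

/-- Membership: `x ∈ tracelessSub n ↔ Σ xᵢ = 0`. -/
theorem mem_tracelessSub_iff (x : EuclideanSpace ℝ (Fin n)) : x ∈ tracelessSub n ↔ ∑ i, x i = 0 := by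
  rw [tracelessSub, Submodule.mem_orthogonal_singleton_iff_inner_right, inner_ones_left]

/-- **The engine's traceless step** `x ↦ x − mean(x)·𝟙`, `mean(x) = (Σ xᵢ)/n`. -/
noncomputable def subMean (x : EuclideanSpace ℝ (Fin n)) : EuclideanSpace ℝ (Fin n) :=
  x - ((∑ i, x i) / n) • ones n

/-- **Subtracting the mean is the orthogonal projection onto the traceless hyperplane** (`n ≥ 1`). -/
theorem subMean_eq_starProjection [NeZero n] (x : EuclideanSpace ℝ (Fin n)) :
    subMean n x = (tracelessSub n).starProjection x := by
  symm
  refine Submodule.eq_starProjection_of_mem_of_inner_eq_zero ?_ fun w hw => ?_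
  · rw [mem_tracelessSub_iff, subMean]
    have hn : (n : ℝ) ≠ 0 := Nat.cast_ne_zero.2 (NeZero.ne n)
    simp only [PiLp.sub_apply, PiLp.smul_apply, ones_apply, smul_eq_mul, mul_one, Finset.sum_sub_distrib,
      Finset.sum_const, Finset.card_univ, Fintype.card_fin, nsmul_eq_mul]
    field_simp
    ring
  · rw [mem_tracelessSub_iff] at hw
    rw [subMean, sub_sub_cancel, real_inner_smul_left, inner_ones_left, hw, mul_zero]

/-- `subMean` is measurable. -/
theorem measurable_subMean : Measurable (subMean n) := by
  have hsum : Measurable fun x : EuclideanSpace ℝ (Fin n) => ∑ i, x i :=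
    Finset.measurable_sum _ fun i _ => (measurable_pi_apply i).comp (measurable_ofLp 2 _)
  unfold subMean
  exact measurable_id.sub ((hsum.div_const _).smul_const (ones n))

/-- **THE ENGINE'S TRACELESS STEP IS EXACT** (`n ≥ 1`): `x ↦ x − mean(x)𝟙` pushes the standard
Gaussian `N(0, I_n)` forward to the standard Gaussian of the traceless hyperplane (embedded in `ℝⁿ`). -/
theorem stdGaussian_map_subMean [NeZero n] :
    (stdGaussian (EuclideanSpace ℝ (Fin n))).map (subMean n) =
      (stdGaussian (tracelessSub n)).map (Subtype.val : tracelessSub n → EuclideanSpace ℝ (Fin n)) := by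
  have hP : Measurable ((tracelessSub n).orthogonalProjectionOnto : EuclideanSpace ℝ (Fin n) → tracelessSub n) :=
    (tracelessSub n).orthogonalProjectionOnto.continuous.measurable
  have hfun : subMean n = (Subtype.val : tracelessSub n → EuclideanSpace ℝ (Fin n)) ∘
      (tracelessSub n).orthogonalProjectionOnto := by
    funext x
    rw [subMean_eq_starProjection, Function.comp_apply, Submodule.starProjection_apply]
  rw [hfun, ← Measure.map_map measurable_subtype_coe hP, stdGaussian_map_orthogonalProjectionOnto]

end Traceless

end Summit.Ventures.LatticeQCDFlow.Exactness
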